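import Literature.Geometry.Riemannian.MetricFlowWassersteinMonotone
import Literature.Geometry.Riemannian.WassersteinW1Triangle
import Mathlib.MeasureTheory.Measure.RegularityCompacts
import HarnessLib

/-!
# Kantorovich–Rubinstein duality for `d_{W₁}` on complete separable metric spaces

C. Villani, *Topics in Optimal Transportation*, Thm. 1.14 (Kantorovich–Rubinstein):
`d_{W₁}(μ, ν) = sup {∫ u dμ − ∫ u dν : u 1-Lipschitz}` for probability measures with finite first
moments on a Polish space. The tree has the duality on COMPACT metric spaces
(`Literature.MeasureTheory.OptimalTransport.KantorovichRubinstein`, read for `wassersteinW1` in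
`exists_lipschitz_wassersteinW1_le`), which forces compactness hypotheses on the earlier
time-slice throughout the formalization of Bamler 2023, §3.2 (b)–(c) and §4.2. Here we remove
them: **on a complete separable metric space, for probability measures with finite first
moments, `d_{W₁}(μ, ν) ≤ sup_u (∫ u dμ − ∫ u dν)` over bounded `1`-Lipschitz `u`** (the easy
inequality `≥` is `ofReal_integral_sub_integral_le_wassersteinW1`). Proof by compact
approximation: by inner regularity of the finite measures `d(x₀, ·) μ`, `d(x₀, ·) ν` there is a
compact `K ∋ x₀` with `∫_{X∖K} d(x₀, ·) dμ, ∫_{X∖K} d(x₀, ·) dν ≤ η`; the retraction `T := id` on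
`K`, `x₀` off `K` moves `μ, ν` to measures `μ_K, ν_K` carried by `K` at `W₁`-cost `≤ η`; compact
duality on `K` gives a `1`-Lipschitz `ζ` on `K`, which extends (McShane) and truncates to a
bounded `1`-Lipschitz `u` on `X` with `d_{W₁}(μ_K, ν_K) ≤ ∫ u dμ_K − ∫ u dν_K ≤ ∫ u dμ − ∫ u dν + 2η`;
the triangle inequality for `d_{W₁}` (`WassersteinW1Triangle.lean`) concludes.

* `exists_isCompact_isClosed_setLIntegral_compl_lt` — compact sets carrying most of `f μ`;
* `wassersteinW1_le_of_forall_integral_sub_le` — **the duality inequality** in working form: if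
  `∫ u dμ − ∫ u dν ≤ c` for all bounded `1`-Lipschitz `u`, then `d_{W₁}(μ, ν) ≤ c`.

Everything is proved; no definitions, no named facts.

## References

* C. Villani, *Topics in Optimal Transportation*, GSM 58 (AMS 2003), Thm. 1.14 and Remark 1.15
  (Kantorovich–Rubinstein on Polish spaces). [Villani2003]
* R. H. Bamler, *Compactness theory of the space of super Ricci flows*, Invent. Math. 233 (2023),
  §2.1 (`d_{W₁}` via couplings and via Lipschitz functions). [Bamler2023]
-/

noncomputable section

open Set MeasureTheory Filter Topology Metric Function
open scoped ENNReal NNReal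

namespace Literature.Geometry.Riemannian

universe u

variable {X : Type u} [MetricSpace X] [MeasurableSpace X] [BorelSpace X]
  [SecondCountableTopology X] [CompleteSpace X]

/-- A compact set carrying all but `η` of the finite measure `f μ`: `∫_{X ∖ K} f dμ < η` (inner
regularity of finite measures on Polish spaces). [folklore] -/
theorem exists_isCompact_isClosed_setLIntegral_compl_lt (μ : Measure X) [IsFiniteMeasure μ] {f : X → ℝ≥0∞}
    (hfin : ∫⁻ x, f x ∂μ ≠ ∞) {η : ℝ≥0∞} (hη : 0 < η) :
    ∃ K : Set X, IsCompact K ∧ IsClosed K ∧ ∫⁻ x in Kᶜ, f x ∂μ < η := by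
  set ρ := μ.withDensity f with hρ
  have hρuniv : ρ univ = ∫⁻ x, f x ∂μ := by
    rw [hρ, withDensity_apply _ MeasurableSet.univ, Measure.restrict_univ]
  haveI : IsFiniteMeasure ρ := ⟨by rw [hρuniv]; exact lt_top_iff_ne_top.2 hfin⟩
  have hreg := innerRegular_isCompact_isClosed_measurableSet_of_finite ρ
  rcases eq_or_ne (ρ univ) 0 with h0 | h0
  · refine ⟨∅, isCompact_empty, isClosed_empty, ?_⟩
    rw [compl_empty, Measure.restrict_univ, ← hρuniv, h0]
    exact hη
  · have hlt : ρ univ - η < ρ univ := ENNReal.sub_lt_self (measure_ne_top _ _) h0 hη.ne'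
    obtain ⟨K, -, ⟨hKc, hKcl⟩, hK⟩ := hreg MeasurableSet.univ (ρ univ - η) hlt
    refine ⟨K, hKc, hKcl, ?_⟩
    rw [← withDensity_apply _ hKcl.measurableSet.compl, ← hρ]
    have hsum : ρ Kᶜ + ρ K = ρ univ := by
      rw [add_comm]
      exact measure_add_measure_compl hKcl.measurableSet
    by_contra hge
    rw [not_lt] at hge
    have : ρ K ≤ ρ univ - η :=
      calc ρ K = ρ univ - ρ Kᶜ := by rw [← hsum, ENNReal.add_sub_cancel_left (measure_ne_top _ _)]
        _ ≤ ρ univ - η := tsub_le_tsub_left hge _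
    exact absurd hK (not_lt.2 this)

/-- **Kantorovich–Rubinstein duality on complete separable metric spaces, as an upper bound for
`d_{W₁}`**: if `μ, ν` are probability measures with finite first moments and
`∫ u dμ − ∫ u dν ≤ c` for every bounded `1`-Lipschitz `u : X → ℝ`, then `d_{W₁}(μ, ν) ≤ c`.
[cite: Villani2003, Thm. 1.14] -/
theorem wassersteinW1_le_of_forall_integral_sub_le (μ ν : Measure X) [IsProbabilityMeasure μ]
    [IsProbabilityMeasure ν] (x₀ : X) (hμ : ∫⁻ x, edist x₀ x ∂μ ≠ ∞) (hν : ∫⁻ x, edist x₀ x ∂ν ≠ ∞)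
    {c : ℝ≥0∞} (hc : ∀ u : X → ℝ, LipschitzWith 1 u → (∃ C, ∀ x, |u x| ≤ C) →
      ENNReal.ofReal (∫ x, u x ∂μ - ∫ x, u x ∂ν) ≤ c) :
    wassersteinW1 μ ν ≤ c := by
  classical
  refine ENNReal.le_of_forall_pos_le_add fun ε hε _ ↦ ?_
  set η : ℝ := (ε : ℝ) / 4 with hη
  have hη0 : 0 < η := by positivity
  have hη0' : 0 < ENNReal.ofReal η := ENNReal.ofReal_pos.2 hη0
  -- Step 1: a compact `K ∋ x₀` carrying most of the first moments
  obtain ⟨Kμ, hKμc, hKμcl, hKμ⟩ := exists_isCompact_isClosed_setLIntegral_compl_lt μ hμ hη0'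
  obtain ⟨Kν, hKνc, hKνcl, hKν⟩ := exists_isCompact_isClosed_setLIntegral_compl_lt ν hν hη0'
  set K : Set X := {x₀} ∪ (Kμ ∪ Kν) with hK
  have hKc : IsCompact K := isCompact_singleton.union (hKμc.union hKνc)
  have hKcl : IsClosed K := isClosed_singleton.union (hKμcl.union hKνcl)
  have hKm : MeasurableSet K := hKcl.measurableSet
  have hx₀K : x₀ ∈ K := Or.inl rfl
  have hμK : ∫⁻ x in Kᶜ, edist x₀ x ∂μ ≤ ENNReal.ofReal η :=
    (lintegral_mono_set (compl_subset_compl.2 fun x hx ↦ Or.inr (Or.inl hx))).trans hKμ.le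
  have hνK : ∫⁻ x in Kᶜ, edist x₀ x ∂ν ≤ ENNReal.ofReal η :=
    (lintegral_mono_set (compl_subset_compl.2 fun x hx ↦ Or.inr (Or.inr hx))).trans hKν.le
  -- Step 2: the retraction `T` and the measures `ρ_K := T_* ρ` carried by `K`
  set T : X → X := K.piecewise id (fun _ ↦ x₀) with hT
  have hTm : Measurable T := measurable_id.piecewise hKm measurable_const
  have hTin : ∀ x ∈ K, T x = x := fun x hx ↦ piecewise_eq_of_mem _ _ _ hx
  have hTout : ∀ x ∉ K, T x = x₀ := fun x hx ↦ piecewise_eq_of_notMem _ _ _ hx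
  have hTK : ∀ x, T x ∈ K := fun x ↦ by
    by_cases hx : x ∈ K
    · rw [hTin x hx]; exact hx
    · rw [hTout x hx]; exact hx₀K
  have hedT : ∀ x, edist x (T x) ≤ Kᶜ.indicator (fun x ↦ edist x₀ x) x := fun x ↦ by
    by_cases hx : x ∈ K
    · rw [hTin x hx, edist_self]; exact bot_le
    · rw [hTout x hx, indicator_of_mem (mem_compl hx), edist_comm]
  have hWT : ∀ (ρ : Measure X) [IsProbabilityMeasure ρ],
      wassersteinW1 ρ (ρ.map T) ≤ ∫⁻ x in Kᶜ, edist x₀ x ∂ρ := by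
    intro ρ _
    have hm : Measurable fun y ↦ (y, T y) := measurable_id.prodMk hTm
    have hcoup : IsCoupling ρ (ρ.map T) (ρ.map fun y ↦ (y, T y)) := by
      refine ⟨Measure.isProbabilityMeasure_map hm.aemeasurable, ?_, ?_⟩
      · rw [Measure.fst, Measure.map_map measurable_fst hm]
        exact Measure.map_id
      · rw [Measure.snd, Measure.map_map measurable_snd hm]
        rfl
    calc wassersteinW1 ρ (ρ.map T) ≤ ∫⁻ p, edist p.1 p.2 ∂(ρ.map fun y ↦ (y, T y)) :=
          wassersteinW1_le_lintegral hcoup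
      _ = ∫⁻ y, edist y (T y) ∂ρ := lintegral_map measurable_edist hm
      _ ≤ ∫⁻ y, Kᶜ.indicator (fun x ↦ edist x₀ x) y ∂ρ := lintegral_mono hedT
      _ = ∫⁻ x in Kᶜ, edist x₀ x ∂ρ := lintegral_indicator hKm.compl _
  have hcarried : ∀ ρ : Measure X, (ρ.map T) Kᶜ = 0 := fun ρ ↦ by
    rw [Measure.map_apply hTm hKm.compl]
    have : T ⁻¹' Kᶜ = ∅ := eq_empty_of_forall_notMem fun x hx ↦ hx (hTK x)
    rw [this, measure_empty]
  haveI : IsProbabilityMeasure (μ.map T) := Measure.isProbabilityMeasure_map hTm.aemeasurable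
  haveI : IsProbabilityMeasure (ν.map T) := Measure.isProbabilityMeasure_map hTm.aemeasurable
  -- Step 3: the compact type `↥K`
  haveI : CompactSpace K := isCompact_iff_compactSpace.1 hKc
  have hι : MeasurableEmbedding ((↑) : K → X) := MeasurableEmbedding.subtype_coe hKm
  have hmapback : ∀ ρ : Measure X,
      (((ρ.map T).comap ((↑) : K → X)).map ((↑) : K → X)) = ρ.map T := fun ρ ↦ by
    rw [map_comap_subtype_coe hKm]
    refine Measure.restrict_eq_self_of_ae_mem ?_
    rw [ae_iff]
    exact hcarried ρ
  have hprobK : ∀ (ρ : Measure X) [IsProbabilityMeasure ρ],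
      IsProbabilityMeasure ((ρ.map T).comap ((↑) : K → X)) := by
    intro ρ _
    haveI : IsProbabilityMeasure (ρ.map T) := Measure.isProbabilityMeasure_map hTm.aemeasurable
    refine ⟨?_⟩
    rw [hι.comap_apply, image_univ, Subtype.range_coe]
    exact (prob_compl_eq_zero_iff hKm).1 (hcarried ρ)
  haveI := hprobK μ
  haveI := hprobK ν
  -- Step 4: compact duality on `K`, McShane extension and truncation
  obtain ⟨ζ, hζc, hζL, hζW⟩ :=
    exists_lipschitz_wassersteinW1_le ((μ.map T).comap ((↑) : K → X))
      ((ν.map T).comap ((↑) : K → X))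
  obtain ⟨C, hC⟩ := exists_abs_le_of_continuous hζc
  have hC0 : 0 ≤ C := (abs_nonneg _).trans (hC ⟨x₀, hx₀K⟩)
  set f₀ : X → ℝ := fun x ↦ if hx : x ∈ K then ζ ⟨x, hx⟩ else 0 with hf₀
  have hf₀K : ∀ x : K, f₀ x = ζ x := fun x ↦ by simp [hf₀, x.2]
  have hLipOn : LipschitzOnWith 1 f₀ K := by
    refine LipschitzOnWith.of_dist_le_mul fun x hx y hy ↦ ?_
    rw [show f₀ x = ζ ⟨x, hx⟩ from hf₀K ⟨x, hx⟩, show f₀ y = ζ ⟨y, hy⟩ from hf₀K ⟨y, hy⟩]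
    exact hζL.dist_le_mul ⟨x, hx⟩ ⟨y, hy⟩
  obtain ⟨g, hgL, hgEq⟩ := hLipOn.extend_real
  set uu : X → ℝ := fun x ↦ max (min (g x) C) (-C) with huu
  have huL : LipschitzWith 1 uu := (hgL.min_const C).max_const (-C)
  have hub : ∀ x, |uu x| ≤ C := fun x ↦
    abs_le.2 ⟨le_max_right _ _, max_le (min_le_right _ _) (by linarith)⟩
  have huK : ∀ x : K, uu x = ζ x := fun x ↦ by
    have hgx : g x = ζ x := by rw [← hgEq x.2, hf₀K]
    have hb := abs_le.1 (hC x)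
    simp only [huu, hgx, min_eq_left hb.2, max_eq_left hb.1]
  have hum : Measurable uu := huL.continuous.measurable
  -- Step 5: the integrals
  have hint1 : ∀ ρ : Measure X,
      ∫ x, ζ x ∂((ρ.map T).comap ((↑) : K → X)) = ∫ x, uu x ∂(ρ.map T) := fun ρ ↦ by
    have : (fun x : K ↦ ζ x) = fun x : K ↦ uu (x : X) := by
      funext x
      rw [huK x]
    rw [this, ← hι.integral_map, hmapback ρ]
  have hint2 : ∀ (ρ : Measure X) [IsProbabilityMeasure ρ], ∫⁻ x, edist x₀ x ∂ρ ≠ ∞ →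
      |∫ x, uu x ∂(ρ.map T) - ∫ x, uu x ∂ρ| ≤ (∫⁻ x in Kᶜ, edist x₀ x ∂ρ).toReal := by
    intro ρ _ hρ
    rw [integral_map hTm.aemeasurable hum.aestronglyMeasurable]
    have hi1 : Integrable (fun x ↦ uu (T x)) ρ :=
      MetricFlow.integrable_of_bounded_measurable (hum.comp hTm) fun x ↦ hub _
    have hi2 : Integrable uu ρ := MetricFlow.integrable_of_bounded_measurable hum hub
    -- the dominating function `𝟙_{Kᶜ} d(x₀, ·)`
    have hdi : Integrable (fun x ↦ dist x₀ x) ρ := by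
      refine ⟨(continuous_const.dist continuous_id).aestronglyMeasurable, ?_⟩
      rw [hasFiniteIntegral_iff_norm]
      have h1 : (fun x : X ↦ ENNReal.ofReal ‖dist x₀ x‖) = fun x ↦ edist x₀ x := by
        funext x
        rw [Real.norm_eq_abs, abs_of_nonneg dist_nonneg, edist_dist]
      rw [h1]
      exact lt_top_iff_ne_top.2 hρ
    have hdiK : Integrable (Kᶜ.indicator fun x ↦ dist x₀ x) ρ := hdi.indicator hKm.compl
    rw [← integral_sub hi1 hi2]
    calc |∫ x, (uu (T x) - uu x) ∂ρ| ≤ ∫ x, |uu (T x) - uu x| ∂ρ := abs_integral_le_integral_abs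
      _ ≤ ∫ x, Kᶜ.indicator (fun x ↦ dist x₀ x) x ∂ρ := by
          refine integral_mono_of_nonneg (Eventually.of_forall fun x ↦ abs_nonneg _) hdiK
            (Eventually.of_forall fun x ↦ ?_)
          show |uu (T x) - uu x| ≤ Kᶜ.indicator (fun x ↦ dist x₀ x) x
          by_cases hx : x ∈ K
          · rw [hTin x hx, sub_self, abs_zero, indicator_of_notMem (notMem_compl_iff.2 hx)]
          · rw [hTout x hx, indicator_of_mem (mem_compl hx)]
            have h := huL.dist_le_mul x₀ x
            rw [NNReal.coe_one, one_mul, Real.dist_eq] at h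
            exact h
      _ = (∫⁻ x in Kᶜ, edist x₀ x ∂ρ).toReal := by
          have hmeas : Measurable fun x : X ↦ dist x₀ x := by fun_prop
          rw [integral_indicator hKm.compl, integral_eq_lintegral_of_nonneg_ae
            (Eventually.of_forall fun x ↦ (dist_nonneg : (0 : ℝ) ≤ dist x₀ x))
            hmeas.aestronglyMeasurable]
          congr 1
          exact lintegral_congr fun x ↦ (edist_dist x₀ x).symm
  -- Step 6: assembly
  have hmid : wassersteinW1 (μ.map T) (ν.map T) ≤ c + ENNReal.ofReal (2 * η) := by
    have h1 : wassersteinW1 (μ.map T) (ν.map T) ≤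
        wassersteinW1 ((μ.map T).comap ((↑) : K → X)) ((ν.map T).comap ((↑) : K → X)) := by
      have h := wassersteinW1_map_le_of_edist_le (f := ((↑) : K → X)) hι.measurable
        (fun a b ↦ le_rfl) ((μ.map T).comap ((↑) : K → X)) ((ν.map T).comap ((↑) : K → X))
      rwa [hmapback μ, hmapback ν] at h
    refine h1.trans (hζW.trans ?_)
    rw [hint1 μ, hint1 ν]
    have h2 := abs_le.1 (hint2 μ hμ)
    have h3 := abs_le.1 (hint2 ν hν)
    have h4 : (∫⁻ x in Kᶜ, edist x₀ x ∂μ).toReal ≤ η := ENNReal.toReal_le_of_le_ofReal hη0.le hμK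
    have h5 : (∫⁻ x in Kᶜ, edist x₀ x ∂ν).toReal ≤ η := ENNReal.toReal_le_of_le_ofReal hη0.le hνK
    calc ENNReal.ofReal (∫ x, uu x ∂(μ.map T) - ∫ x, uu x ∂(ν.map T))
        ≤ ENNReal.ofReal ((∫ x, uu x ∂μ - ∫ x, uu x ∂ν) + 2 * η) :=
          ENNReal.ofReal_le_ofReal (by linarith)
      _ ≤ ENNReal.ofReal (∫ x, uu x ∂μ - ∫ x, uu x ∂ν) + ENNReal.ofReal (2 * η) :=
          ENNReal.ofReal_add_le
      _ ≤ c + ENNReal.ofReal (2 * η) := add_le_add (hc uu huL ⟨C, hub⟩) le_rfl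
  have hεη : ENNReal.ofReal η + ENNReal.ofReal (2 * η) + ENNReal.ofReal η = (ε : ℝ≥0∞) := by
    rw [← ENNReal.ofReal_add hη0.le (by positivity), ← ENNReal.ofReal_add (by positivity) hη0.le,
      show η + 2 * η + η = (ε : ℝ) by rw [hη]; ring, ENNReal.ofReal_coe_nnreal]
  calc wassersteinW1 μ ν ≤ wassersteinW1 μ (μ.map T) + wassersteinW1 (μ.map T) ν :=
        wassersteinW1_triangle _ _ _
    _ ≤ wassersteinW1 μ (μ.map T) + (wassersteinW1 (μ.map T) (ν.map T) +
          wassersteinW1 (ν.map T) ν) := add_le_add le_rfl (wassersteinW1_triangle _ _ _)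
    _ ≤ ENNReal.ofReal η + ((c + ENNReal.ofReal (2 * η)) + ENNReal.ofReal η) := by
        gcongr
        · exact (hWT μ).trans hμK
        · rw [wassersteinW1_comm]
          exact (hWT ν).trans hνK
    _ = c + (ENNReal.ofReal η + ENNReal.ofReal (2 * η) + ENNReal.ofReal η) := by ring
    _ = c + ε := by rw [hεη]

end Literature.Geometry.Riemannian

end
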